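import Summits.Ventures.PercRepro.S1CoreCapFat

/-!
# PercRepro — a 6-point plane of the e-free core is not two disjoint lines (p1, gen 21;
`proofs/P1-S4-PERPOINT.md` §9 (2))

If `P = {e, a, b} ⊔ {c, x, y}` is a 6-point plane of the e-free core with both triples of rank `≤ 2`, then at the
point `a` the two sides of `a` inside `P` (from `hfree` at `a`, intersected with `P ∖ {a}`) are disjoint, cover the
five points of `P ∖ {a}`, have rank `≤ 2` (a rank-3 subset of `P` spans `P ∋ a`) and hence ≤ 3 points each, so they
have sizes `(3, 2)`; the 3-side `T` contains at most one of `e, b` (else `T = {e, a, b} ∋ a`), so `T` meets `{c, x, y}`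
in ≥ 2 points and `T = {c, x, y}`; the 2-side is then `{e, b}`, but `a ∈ cl {e, b}` — contradiction.
* **`not_two_disjoint_triples_in_six_plane`** (the exclusion used by the cap `cap(5) = 5`).
Axioms: standard.
-/

open scoped Matroid

namespace PercRepro

namespace S1

open Set

variable {α : Type}

/-- **No two disjoint lines in a 6-point plane of the core**: `{e, a, b}` and `{c, x, y}` of rank `≤ 2`, pairwise
distinct points of a 6-point plane `P` with `a, b ∉ {c, x, y}`, is impossible on the e-free core. -/
theorem not_two_disjoint_triples_in_six_plane (M : Matroid α) [M.Finite]
    (hfree : ∀ e ∈ M.E, ∃ A ⊆ M.E \ {e}, e ∉ M.closure A ∧ e ∉ M.closure ((M.E \ {e}) \ A))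
    {P : Set α} (hP : P ⊆ M.E) (hrP : M.eRk P ≤ 3) (h6 : P.ncard = 6)
    {e a b c x y : α} (he : e ∈ P) (haP : a ∈ P) (hbP : b ∈ P) (hcP : c ∈ P) (hxP : x ∈ P) (hyP : y ∈ P)
    (hae : a ≠ e) (hbe : b ≠ e) (hab : a ≠ b) (hca : c ≠ a) (hcb : c ≠ b) (hce : c ≠ e)
    (hxe : x ≠ e) (hye : y ≠ e) (hxc : x ≠ c) (hyc : y ≠ c) (hxy : x ≠ y)
    (hrab : M.eRk {e, a, b} ≤ 2) (hrcxy : M.eRk {c, x, y} ≤ 2)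
    (hmeet : a ∉ ({c, x, y} : Set α) ∧ b ∉ ({c, x, y} : Set α)) : False := by
  classical
  have hPfin : P.Finite := M.ground_finite.subset hP
  have hLS2 : ∀ X ⊆ M.E, M.eRk X ≤ 2 → X.ncard ≤ 3 := by
    intro X hX h
    have := ThmN.ncard_add_one_le_two_pow_of_eRk_le M (ThmN.not_isLoop_of_free M hfree) hfree 2 X hX h
    omega
  have hT3 : ({c, x, y} : Set α).ncard = 3 := ncard_eq_three.2 ⟨c, x, y, hxc.symm, hyc.symm, hxy, rfl⟩
  have hTe : ∀ t ∈ ({c, x, y} : Set α), t ≠ e := by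
    intro t ht; simp only [mem_insert_iff, mem_singleton_iff] at ht
    rcases ht with rfl | rfl | rfl; exact hce; exact hxe; exact hye
  have hTE : ({c, x, y} : Set α) ⊆ M.E := by
    intro t ht; simp only [mem_insert_iff, mem_singleton_iff] at ht
    rcases ht with rfl | rfl | rfl; exact hP hcP; exact hP hxP; exact hP hyP
  have hEab : ({e, a, b} : Set α) ⊆ M.E := by
    intro t ht; simp only [mem_insert_iff, mem_singleton_iff] at ht
    rcases ht with rfl | rfl | rfl; exact hP he; exact hP haP; exact hP hbP
  have h3ab : ({e, a, b} : Set α).ncard = 3 := ncard_eq_three.2 ⟨e, a, b, hae.symm, hbe.symm, hab, rfl⟩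
  exfalso
  -- the two sides of `a` inside `P`
  obtain ⟨A', hA'sub, haA', haB'⟩ := hfree a (hP haP)
  set S₁ := A' ∩ (P \ {a}) with hS₁
  set S₂ := ((M.E \ {a}) \ A') ∩ (P \ {a}) with hS₂
  have hS₁P : S₁ ⊆ P \ {a} := inter_subset_right
  have hS₂P : S₂ ⊆ P \ {a} := inter_subset_right
  have hcov : P \ {a} ⊆ S₁ ∪ S₂ := by
    intro t ht
    by_cases htA : t ∈ A'
    · exact Or.inl ⟨htA, ht⟩
    · exact Or.inr ⟨⟨⟨hP ht.1, ht.2⟩, htA⟩, ht⟩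
  have hPa5 : (P \ {a}).ncard = 5 := by
    have := ncard_sdiff_singleton_add_one haP hPfin; omega
  -- each side has rank ≤ 2 (a rank-3 subset of `P` spans `P ∋ a`) and `a` is outside its closure
  have hside : ∀ S : Set α, S ⊆ P \ {a} → a ∉ M.closure S → M.eRk S ≤ 2 ∧ S.ncard ≤ 3 := by
    intro S hSP hnot
    have hSE : S ⊆ M.E := hSP.trans (sdiff_subset.trans hP)
    have hr2 : M.eRk S ≤ 2 := by
      by_contra hgt
      push Not at hgt
      have h3 : (3 : ℕ∞) ≤ M.eRk S := Order.add_one_le_of_lt hgt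
      have hSP' : S ⊆ P := hSP.trans sdiff_subset
      have hcl : M.closure S = M.closure P :=
        (M.isRkFinite_of_finite (hPfin.subset hSP')).closure_eq_closure_of_subset_of_eRk_ge_eRk hSP'
          (hrP.trans h3)
      exact hnot (hcl ▸ M.subset_closure P hP haP)
    exact ⟨hr2, hLS2 S hSE hr2⟩
  obtain ⟨h1r, h1c⟩ := hside S₁ hS₁P (fun h => haA' (M.closure_subset_closure inter_subset_left h))
  obtain ⟨h2r, h2c⟩ := hside S₂ hS₂P (fun h => haB' (M.closure_subset_closure inter_subset_left h))
  have hS₁fin : S₁.Finite := hPfin.subset (hS₁P.trans sdiff_subset)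
  have hS₂fin : S₂.Finite := hPfin.subset (hS₂P.trans sdiff_subset)
  have hcard : 5 ≤ S₁.ncard + S₂.ncard := by
    have := (ncard_le_ncard hcov (hS₁fin.union hS₂fin)).trans (ncard_union_le S₁ S₂)
    omega
  have hdisj : Disjoint S₁ S₂ := by
    rw [Set.disjoint_left]
    intro t ht1 ht2
    rw [hS₁] at ht1
    rw [hS₂] at ht2
    exact ht2.1.2 ht1.1
  have hcard' : S₁.ncard + S₂.ncard ≤ 5 := by
    rw [← ncard_union_eq hdisj hS₁fin hS₂fin, ← hPa5]
    exact ncard_le_ncard (union_subset hS₁P hS₂P) (hPfin.subset sdiff_subset)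
  have hcard5 : S₁.ncard + S₂.ncard = 5 := le_antisymm hcard' hcard
  -- the 3-side `T` and the 2-side `R`
  obtain ⟨T, R, hTP, hRP, hTR, hrT, hT3', hrR, hR2, haT, haR⟩ :
      ∃ T R : Set α, T ⊆ P \ {a} ∧ R ⊆ P \ {a} ∧ P \ {a} ⊆ T ∪ R ∧ M.eRk T ≤ 2 ∧ T.ncard = 3 ∧
        M.eRk R ≤ 2 ∧ R.ncard ≤ 2 ∧ a ∉ M.closure T ∧ a ∉ M.closure R := by
    have key : ∀ m n : ℕ, m + n = 5 → m ≤ 3 → n ≤ 3 →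
        (m < 3 → n = 3 ∧ m ≤ 2) ∧ (3 ≤ m → m = 3 ∧ n ≤ 2) := by
      intro m n h1 h2 h3
      exact ⟨fun h => ⟨by omega, by omega⟩, fun h => ⟨by omega, by omega⟩⟩
    rcases Nat.lt_or_ge S₁.ncard 3 with hlt | hge
    · obtain ⟨hS2_3, hS1_2⟩ := (key _ _ hcard5 h1c h2c).1 hlt
      exact ⟨S₂, S₁, hS₂P, hS₁P, by rw [union_comm]; exact hcov, h2r, hS2_3, h1r, hS1_2,
        fun h => haB' (M.closure_subset_closure inter_subset_left h),
        fun h => haA' (M.closure_subset_closure inter_subset_left h)⟩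
    · obtain ⟨hS1_3, hS2_2⟩ := (key _ _ hcard5 h1c h2c).2 hge
      exact ⟨S₁, S₂, hS₁P, hS₂P, hcov, h1r, hS1_3, h2r, hS2_2,
        fun h => haA' (M.closure_subset_closure inter_subset_left h),
        fun h => haB' (M.closure_subset_closure inter_subset_left h)⟩
  have hTE' : T ⊆ M.E := hTP.trans (sdiff_subset.trans hP)
  -- `T` contains at most one of `e, b`
  have hTeb : ¬ (e ∈ T ∧ b ∈ T) := by
    rintro ⟨heT, hbT⟩
    have hne' : ({e, a, b} : Set α) ≠ T := fun h => haT (h ▸ M.subset_closure _ hEab (by simp))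
    have hint := inter_ncard_le_one_of_triples M hfree hEab hTE' hrab hrT h3ab hT3' hne'
    have : ({e, b} : Set α) ⊆ {e, a, b} ∩ T := by
      intro u hu; simp only [mem_insert_iff, mem_singleton_iff] at hu
      rcases hu with rfl | rfl
      · exact ⟨by simp, heT⟩
      · exact ⟨by simp, hbT⟩
    have := ncard_le_ncard this ((toFinite _).inter_of_left _)
    rw [ncard_pair hbe.symm] at this; omega
  -- hence `T` has ≥ 2 points of `{c, x, y}`, so `T = {c, x, y}`
  have hTcxy : T = {c, x, y} := by
    have hTsub : T ⊆ ({e, b} : Set α) ∪ {c, x, y} := by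
      intro u hu
      have huP : u ∈ P := (hTP hu).1
      have hua : u ≠ a := (hTP hu).2
      -- `P = {e, a, b, c, x, y}` (six distinct points)
      by_contra hno
      simp only [mem_union, mem_insert_iff, mem_singleton_iff, not_or] at hno
      obtain ⟨⟨hue, hub⟩, huc, hux, huy⟩ := hno
      have h7 : ({e, a, b, c, x, y, u} : Set α) ⊆ P := by
        intro z hz; simp only [mem_insert_iff, mem_singleton_iff] at hz
        rcases hz with rfl | rfl | rfl | rfl | rfl | rfl | rfl
        · exact he
        · exact haP
        · exact hbP
        · exact hcP
        · exact hxP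
        · exact hyP
        · exact huP
      have h7c : ({e, a, b, c, x, y, u} : Set α).ncard = 7 := by
        have hxa : x ≠ a := fun h => hmeet.1 (by rw [← h]; simp)
        have hxb : x ≠ b := fun h => hmeet.2 (by rw [← h]; simp)
        have hya : y ≠ a := fun h => hmeet.1 (by rw [← h]; simp)
        have hyb : y ≠ b := fun h => hmeet.2 (by rw [← h]; simp)
        have hue' : e ≠ u := fun h => hue h.symm
        have hub' : b ≠ u := fun h => hub h.symm
        have huc' : c ≠ u := fun h => huc h.symm
        have hux' : x ≠ u := fun h => hux h.symm
        have huy' : y ≠ u := fun h => huy h.symm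
        rw [ncard_insert_of_notMem (by simp [hae.symm, hbe.symm, hce.symm, hxe.symm, hye.symm, hue']) (toFinite _),
          ncard_insert_of_notMem (by simp [hab, hca.symm, hxa.symm, hya.symm, hua.symm]) (toFinite _),
          ncard_insert_of_notMem (by simp [hcb.symm, hxb.symm, hyb.symm, hub']) (toFinite _),
          ncard_insert_of_notMem (by simp [hxc.symm, hyc.symm, huc']) (toFinite _),
          ncard_eq_three.2 ⟨x, y, u, hxy, hux', huy', rfl⟩]
      have := ncard_le_ncard h7 hPfin
      omega
    have hTeb' : (T ∩ {e, b}).ncard ≤ 1 := by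
      by_contra hgt
      push Not at hgt
      have : ({e, b} : Set α) ⊆ T := by
        intro u hu
        have hsub : T ∩ {e, b} ⊆ {e, b} := inter_subset_right
        have heq : T ∩ {e, b} = {e, b} :=
          eq_of_subset_of_ncard_le hsub (by rw [ncard_pair hbe.symm]; omega) (toFinite _)
        have hu' : u ∈ T ∩ {e, b} := by rw [heq]; exact hu
        exact hu'.1
      exact hTeb ⟨this (by simp), this (by simp)⟩
    have hTcxy2 : 2 ≤ (T ∩ {c, x, y}).ncard := by
      have hsplit : T ⊆ (T ∩ {e, b}) ∪ (T ∩ {c, x, y}) := by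
        intro u hu
        rcases hTsub hu with h | h
        · exact Or.inl ⟨hu, h⟩
        · exact Or.inr ⟨hu, h⟩
      have hTfin : T.Finite := hPfin.subset (hTP.trans sdiff_subset)
      have := (ncard_le_ncard hsplit ((hTfin.subset inter_subset_left).union (hTfin.subset inter_subset_left))).trans
        (ncard_union_le _ _)
      omega
    by_contra hneq
    have := inter_ncard_le_one_of_triples M hfree hTE' hTE hrT hrcxy hT3' hT3 hneq
    omega
  -- then the 2-side contains `e` and `b`, yet `a ∈ cl {e, b}`
  have heR : e ∈ R := by
    have heP : e ∈ P \ {a} := ⟨he, hae.symm⟩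
    rcases hTR heP with h | h
    · exact absurd h (by rw [hTcxy]; intro h'; exact hTe _ h' rfl)
    · exact h
  have hbR : b ∈ R := by
    have hbP' : b ∈ P \ {a} := ⟨hbP, hab.symm⟩
    rcases hTR hbP' with h | h
    · exact absurd h (by rw [hTcxy]; exact hmeet.2)
    · exact h
  have hebR : ({e, b} : Set α) ⊆ R := by
    intro u hu; simp only [mem_insert_iff, mem_singleton_iff] at hu
    rcases hu with rfl | rfl; exact heR; exact hbR
  have hebE : ({e, b} : Set α) ⊆ M.E := by
    intro u hu; simp only [mem_insert_iff, mem_singleton_iff] at hu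
    rcases hu with rfl | rfl; exact hP he; exact hP hbP
  have hr2 : (2 : ℕ∞) ≤ M.eRk {e, b} :=
    ThmN.two_le_eRk_of_two_le_ncard_of_free M hfree hebE (by rw [ncard_pair hbe.symm])
  have hcl : M.closure {e, b} = M.closure {e, a, b} :=
    (M.isRkFinite_of_finite (toFinite _)).closure_eq_closure_of_subset_of_eRk_ge_eRk
      (by intro u hu; simp only [mem_insert_iff, mem_singleton_iff] at hu ⊢; tauto) (hrab.trans hr2)
  have haeb : a ∈ M.closure {e, b} := by
    rw [hcl]; exact M.subset_closure _ hEab (by simp)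
  exact haR (M.closure_subset_closure hebR haeb)

end S1

end PercRepro
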